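import Summits.HodgeConjecture.HodgeConjecture.Theorems.R90S4CartanMeasures                  -- ★ p863623 (this seat, (B2-N)): `cartanWeight`, `plainCartanMeasure`, `stableCartanMeasure`, `isPlainWeylMeasure_plainCartanMeasure` (+ the LH6 Weyl tower)
import Summits.HodgeConjecture.HodgeConjecture.Theorems.R90S4OneDimCharTransferOfWeylPair     -- ★ p862981 (this seat, (W6-B4)): `IsStableWeylMeasure` (+ ★ `IsStablyConjGAt`, `stableOrbitalIntegralRel`)
import Summits.HodgeConjecture.HodgeConjecture.Theorems.R90S4EpsCentralizerMeasureTransport   -- ★ p862879 (K2E3-p36, (W5-B3) file 2): `haar_map_eq_of_apply_compactCore_eq_one` (core-one Haar measures correspond under `≃ₜ*`)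
import HarnessLib

/-!
# R90-TF · S4 «Ch. 13.1–2», brick (B2-S) part 1 — THE STABLE-TRANSPORT DICTIONARY OF A CARTAN SYSTEM AND THE TRANSPORT LEMMAS (Rogawski 1990, §3.6 pp. 28–31 «stable
# conjugacy classes of Cartan subgroups … `𝔇(T∕F)`»; §12.5 p. 182 «the number of `ν ∈ 𝔇(T∕F)` such that `T^ν` is conjugate to `T″` is `|Ω_F(T)|∕|Ω(T″)|`»; §4.3 (4.3.1) p. 43)

Cell `hodgecm-mathlib`, crux H413 (`stmt-HodgeConjecture-24833`, lane `--supports … --as helper`), route of record `HCCMUnconditional` (no route verbs;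
count-neutral).  Programme R90-TF, section S4, dealer K2E2-plan (g7): RULINGS S4-R25 (2) «(B2-S) head over a `def IsStableTransportDict`» and S4-R26 (4) «also export the
TRANSPORT lemma both payers use»; seat K2E3-p12 (g10).  PART 1 of 2 (the 400-line rule): the DICTIONARY (one `Prop`-valued definition, review lane D-0009) + the transport and
integrability lemmas; PART 2 = `R90S4StableRegroupOfPlain` (the regrouping and the head `isStableWeylMeasure_stableCartanMeasure_of_dict`).  Toward the named input (W-NP) of
FILE C ED. 5's `stub_R90_S4_weylNormPair` (★ p862981): its first conjunct `IsStableWeylMeasure … (stableCartanMeasure L v C tT n)` (★ (B2-N) p863623, the term of record).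

## CONTENTS (`G_v = Gqs L v = U(Φ₃)(L⁺_v)`, `v` non-split where stated)
* §1 stable-conjugacy helpers: `isStablyConjGAt_of_isConj`, `isStablyConjGAt_conj`, `charpoly_eq_of_isStablyConjGAt`, `cartanWeight_eq_of_isStablyConjGAt` (off `M` the Weyl
  weight ★ `cartanWeight` is a stable-class function — the (DICT) hands discharge clause (W) with it).
* §2 **`IsStableTransportDict L v C n`** — the dictionary, five clauses: (S) pointwise stable conjugacy of the transports `e_{T,j} : T ≃ₜ* T_j`, (W) weight compatibility,
  (B) enumeration of the stable class at regular points as a `Set.BijOn` onto ★ `stableOrbitalIntegralRel`'s index set `{c | t ∼_{st} out c}` (verbatim), (N) `n = m_T` on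
  `T^{reg}`, (C) the Weyl count.  Payers per Cartan type: (3) cubic K2E3-p27, (2) `K¹ × E¹` R90-C131-p04, (1) `(E¹)³` open; type (0) `M` is ★ p863493 (`m_M = 1`, `e = refl`).
* §3 TRANSPORT (S4-R26 (4), for BOTH (W-NP) payers): `map_restrict_regular_eq_of_transport` (`e_*(t_T|_{T^{reg}}) = t_{T′}|_{T′^{reg}}` for core-one Haar measures, ★
  `haar_map_eq_of_apply_compactCore_eq_one`), `setIntegral_comp_transport_eq` (change of variables, any integrand), `setIntegral_cartanWeight_smul_eq_of_transport`
  (`∫_{T′^{reg}} D_{T′} G dt_{T′} = ∫_{T^{reg}} D_T G dt_T` for stable-invariant `G`).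
* §4 `integrable_cartanWeight_smul_classOrbitalIntegral_mul` — per-member integrability of `D_T · Φ(⟦·⟧, f) · α` on `T^{reg}` (★ (E1b), the torus factor, as inside ★ (B2-N)'s
  proof; exported because PART 2 interchanges `∫_{T^{reg}}` with the finite sum `Φ^{st} = Σ_j Φ(⟦e_j ·⟧, f)`).

HONEST LABEL: HC_CM is proved only modulo the 7 printed citations (2 remaining named inputs: hLiu418 = stmt-HodgeConjecture-24832, h413 = stmt-HodgeConjecture-24833) until rung 0
closes.  Hypothesis-side vocabulary + lemmas; discharges no named input ((W-NP) OPEN).  REL ≠ ★ ≠ BUILT.  No instance, no notation, no `sorry`.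

## References
* [Rogawski1990] J. D. Rogawski, *Automorphic Representations of Unitary Groups in Three Variables*, Ann. of Math. Stud. 123 (1990), §3.6 pp. 28–31; §12.5 p. 182; §4.3 (4.3.1) p. 43.
* [HarishChandra1970] Harish-Chandra (notes by G. van Dijk), *Harmonic analysis on reductive p-adic groups*, LNM 162 (1970), Lemmas 22, 42.
-/

set_option autoImplicit false
set_option linter.dupNamespace false

noncomputable section

open MeasureTheory Measure Set Filter Topology Function NumberField IsDedekindDomain
open Literature.MeasureTheory.Group
open Literature.NumberTheory.Automorphic Literature.NumberTheory.Automorphic.UnitaryGroup Literature.NumberTheory.Rogawski1990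
open Summit.HodgeConjecture.HodgeConjecture.Cruxes.H413
open Summit.HodgeConjecture.HodgeConjecture.Cruxes.H413.F0P3cStCharTSWeylCartanRadial
open Summit.HodgeConjecture.HodgeConjecture.Cruxes.H413.F0P3cStCharTSWeylCartanJacobian
open Summit.HodgeConjecture.HodgeConjecture.Cruxes.H413.F0P3cStCharTSWeylCartanOrbInt
open Summit.HodgeConjecture.HodgeConjecture.Cruxes.H413.F0P3cStCharTSWeylCartanWIF
open Summit.HodgeConjecture.HodgeConjecture.Cruxes.H413.F0P3cStCharTSWeylHypMeasure
open Summit.HodgeConjecture.HodgeConjecture.Cruxes.H413.F0P3cStCharTSWeylHypJacobianCartanM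
open scoped ENNReal NNReal MatrixGroups Pointwise

namespace Summit.HodgeConjecture.HodgeConjecture.R90.S4

section StableTransportDict

variable (L : Type) [Field L] [NumberField L] [IsCMField L] (v : HeightOneSpectrum (𝓞 ↥(maximalRealSubfield L)))

/-! ## §1 Stable conjugacy helpers -/

variable {L v} in
/-- Conjugate elements of `G_v` are stably conjugate (the conjugator, read in `G̃_v = GL₃(L ⊗ L⁺_v)`). [cite: Rogawski1990, §3.1 p. 19] -/
theorem isStablyConjGAt_of_isConj {γ γ' : Gqs L v} (h : IsConj γ γ') : IsStablyConjGAt L (R90.S4.splitFormGL L) v γ γ' := by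
  obtain ⟨c, hc⟩ := isConj_iff.mp h
  exact isConj_iff.mpr ⟨(c.val : GL (Fin 3) (LocalRing L v)), by rw [← hc]; rfl⟩

/-- `γ` and `x γ x⁻¹` are stably conjugate. [cite: Rogawski1990, §3.1 p. 19] -/
theorem isStablyConjGAt_conj (x γ : Gqs L v) : IsStablyConjGAt L (R90.S4.splitFormGL L) v γ (x * γ * x⁻¹) :=
  isStablyConjGAt_of_isConj (isConj_iff.mpr ⟨x, rfl⟩)

variable {L v} in
/-- Stably conjugate elements of `G_v` have the same characteristic polynomial in `GL₃(L ⊗ L⁺_v)`. [cite: Rogawski1990, §3.1 p. 19] -/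
theorem charpoly_eq_of_isStablyConjGAt {γ γ' : Gqs L v} (h : IsStablyConjGAt L (R90.S4.splitFormGL L) v γ γ') :
    ((γ'.val : GL (Fin 3) (LocalRing L v)).val).charpoly = ((γ.val : GL (Fin 3) (LocalRing L v)).val).charpoly := by
  obtain ⟨c, hc⟩ := isConj_iff.mp h
  rw [← hc, Units.val_mul, Units.val_mul, Matrix.coe_units_inv, Matrix.charpoly_units_conj]

variable {L v} in
/-- **Off the split Cartan the Weyl weight is a stable-class function**: for members `T, T′ ≠ M` and stably conjugate `t ∈ T`, `t′ ∈ T′`,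
`cartanWeight T′ t′ = cartanWeight T t` (both are `√(∏_w |disc χ|_w (∏_w |det|_w)⁻²)` of the common characteristic polynomial).  The (DICT) hands discharge
clause (W) of `IsStableTransportDict` with it. [cite: Rogawski1990, §12.5 p. 182; §4.9 p. 54] -/
theorem cartanWeight_eq_of_isStablyConjGAt {T T' : Subgroup (Gqs L v)} (hT : T ≠ (cmBorelTriple L 3 v).M) (hT' : T' ≠ (cmBorelTriple L 3 v).M)
    {t : ↥T} {t' : ↥T'} (h : IsStablyConjGAt L (R90.S4.splitFormGL L) v (t : Gqs L v) (t' : Gqs L v)) :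
    cartanWeight L v T' t' = cartanWeight L v T t := by
  have hcp := charpoly_eq_of_isStablyConjGAt h
  have hdet : (((t' : Gqs L v).val : GL (Fin 3) (LocalRing L v)).val).det = (((t : Gqs L v).val : GL (Fin 3) (LocalRing L v)).val).det := by
    rw [Matrix.det_eq_sign_charpoly_coeff, Matrix.det_eq_sign_charpoly_coeff, hcp]
  rw [cartanWeight_of_ne L v hT, cartanWeight_of_ne L v hT']
  simp only [hcp, hdet]

/-! ## §2 The stable-transport dictionary of a Cartan system -/

/-- **THE STABLE-TRANSPORT DICTIONARY (DICT) of a Cartan system `C` of `U(Φ₃)(L⁺_v)`, with class-count `n`** (§3.6 pp. 28–31, §12.5 p. 182): there are, for every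
member `T ∈ C`, a number `m_T` and `m_T` TRANSPORTS `e_{T,j} : T ≃ₜ* T_j` (`j < m_T`) into members `T_j ∈ C` (isomorphisms of topological groups), such that
* (S) `e_{T,j} t` is stably conjugate to `t` for every `t ∈ T` (★ `IsStablyConjGAt` = conjugacy in `GL₃(L ⊗ L⁺_v)`);
* (W) the Weyl weights correspond on regular elements: `D_{T_j}(e_{T,j} t) = D_T(t)` (★ `cartanWeight`; automatic off `M` by `cartanWeight_eq_of_isStablyConjGAt`);
* (B) for regular `t ∈ T`, `j ↦ ⟦e_{T,j} t⟧` is a BIJECTION from `{j < m_T}` onto the index set `{c | t ∼_{st} out c}` of ★ `stableOrbitalIntegralRel` at `t` — the conjugacy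
  classes inside the stable class of `t` (so `Φ^{st}(t, f) = Σ_j Φ(⟦e_{T,j} t⟧, f)`, and the finiteness of `𝔇(T∕F)` rides this clause);
* (N) `n(t) = m_T` for regular `t ∈ T` (`= |𝔇(T∕F)|`: 1, 4, 2, 1 on the Cartans of types (0)–(3));
* (C) the WEYL COUNT: for every member `T′`, `Σ_{T ∈ C} #{j : T_j = T′} · ([N(T):T] · m_T)⁻¹ = [N(T′):T′]⁻¹` (p. 182: «the number of `ν ∈ 𝔇(T∕F)` such that `T^ν` is conjugate
  to `T″` is `|Ω_F(T)|∕|Ω(T″)|`», summed over the stable class of `T′`; type (1): `1·(6·4)⁻¹ + 1·(2·4)⁻¹ = 6⁻¹`, `3·(6·4)⁻¹ + 3·(2·4)⁻¹ = 2⁻¹`).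
It is exactly what turns the plain Weyl formula for `plainCartanMeasure C tT` into the stable one for `stableCartanMeasure C tT n` (§6). [cite: Rogawski1990, §3.6 pp. 28–31; §12.5 p. 182] -/
def IsStableTransportDict (C : Finset (Subgroup (Gqs L v))) (n : Gqs L v → ℕ) : Prop :=
  ∃ (m : ↥C → ℕ) (τ : ∀ i : ↥C, Fin (m i) → ↥C)
    (e : ∀ (i : ↥C) (j : Fin (m i)), ↥(i : Subgroup (Gqs L v)) ≃ₜ* ↥((τ i j : ↥C) : Subgroup (Gqs L v))),
    (∀ (i : ↥C) (j : Fin (m i)) (t : ↥(i : Subgroup (Gqs L v))),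
        IsStablyConjGAt L (R90.S4.splitFormGL L) v (t : Gqs L v) ((e i j t : ↥((τ i j : ↥C) : Subgroup (Gqs L v))) : Gqs L v)) ∧
    (∀ (i : ↥C) (j : Fin (m i)) (t : ↥(i : Subgroup (Gqs L v))), IsRegularElt (((t : Gqs L v)).val : GL (Fin 3) (LocalRing L v)) →
        cartanWeight L v ((τ i j : ↥C) : Subgroup (Gqs L v)) (e i j t) = cartanWeight L v (i : Subgroup (Gqs L v)) t) ∧
    (∀ (i : ↥C) (t : ↥(i : Subgroup (Gqs L v))), IsRegularElt (((t : Gqs L v)).val : GL (Fin 3) (LocalRing L v)) →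
        Set.BijOn (fun j : Fin (m i) => ConjClasses.mk ((e i j t : ↥((τ i j : ↥C) : Subgroup (Gqs L v))) : Gqs L v)) Set.univ
          {c : ConjClasses (Gqs L v) | IsStablyConjGAt L (R90.S4.splitFormGL L) v (t : Gqs L v) (Quotient.out c)}) ∧
    (∀ (i : ↥C) (t : ↥(i : Subgroup (Gqs L v))), IsRegularElt (((t : Gqs L v)).val : GL (Fin 3) (LocalRing L v)) → n (t : Gqs L v) = m i) ∧
    (∀ k : ↥C, ∑ i : ↥C, (Nat.card {j : Fin (m i) // τ i j = k} : ℝ) *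
        (((((i : Subgroup (Gqs L v)).subgroupOf (Subgroup.normalizer ((i : Subgroup (Gqs L v)) : Set (Gqs L v)))).index : ℝ))⁻¹ * ((m i : ℝ))⁻¹) =
      ((((k : Subgroup (Gqs L v)).subgroupOf (Subgroup.normalizer ((k : Subgroup (Gqs L v)) : Set (Gqs L v)))).index : ℝ))⁻¹)

/-! ## §3 Transport along a stable-conjugating isomorphism of tori (S4-R26 (4): the lemma both payers use) -/

/-- **TRANSPORT, measure level**: let `e : T ≃ₜ* T′` be an isomorphism of topological groups between subgroups of `U(Φ₃)(L⁺_v)` (`v` non-split, `T′` closed) with `e t`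
stably conjugate to `t` for all `t`, and let `t_T`, `t_{T′}` be Haar measures of mass one on the compact cores.  Then `e` carries `t_T|_{T^{reg}}` to `t_{T′}|_{T′^{reg}}`
(★ `haar_map_eq_of_apply_compactCore_eq_one`: the core-one Haar measures correspond; regularity is a stable-class function, ★ `isRegularElt_of_isConj`).
[cite: Rogawski1990, §4.3 (4.3.1) p. 43; §12.5 p. 182] -/
theorem map_restrict_regular_eq_of_transport (hns : ∀ w : PlacesOver L v, IsCMField.complexConj L • w.1 = w.1)
    [MeasurableSpace (Gqs L v)] [BorelSpace (Gqs L v)] {T T' : Subgroup (Gqs L v)} (hT' : IsClosed (T' : Set (Gqs L v)))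
    (e : ↥T ≃ₜ* ↥T') (he : ∀ t : ↥T, IsStablyConjGAt L (R90.S4.splitFormGL L) v (t : Gqs L v) ((e t : ↥T') : Gqs L v))
    (tT : Measure ↥T) [tT.IsHaarMeasure] (tT' : Measure ↥T') [tT'.IsHaarMeasure] (htc : tT (compactCore ↥T) = 1) (htc' : tT' (compactCore ↥T') = 1) :
    Measure.map e (tT.restrict {t : ↥T | IsRegularElt (((t : Gqs L v)).val : GL (Fin 3) (LocalRing L v))}) =
      tT'.restrict {t : ↥T' | IsRegularElt (((t : Gqs L v)).val : GL (Fin 3) (LocalRing L v))} := by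
  obtain ⟨w⟩ := (inferInstance : Nonempty (PlacesOver L v))
  haveI : LocallyCompactSpace (Gqs L v) := locallyCompactSpace_cmDatum_local (L := L) (N := 3) (H := qsForm L) (v := v)
  haveI : SecondCountableTopology (GL (Fin 3) (LocalRing L v)) := secondCountableTopology_localGL (E := L) 3 v
  haveI : SecondCountableTopology (Gqs L v) := TopologicalSpace.Subtype.secondCountableTopology _
  haveI : SecondCountableTopology ↥T' := TopologicalSpace.Subtype.secondCountableTopology _
  haveI : LocallyCompactSpace ↥T' := hT'.isClosedEmbedding_subtypeVal.locallyCompactSpace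
  have hmap : Measure.map e tT = tT' := haar_map_eq_of_apply_compactCore_eq_one e tT tT' htc htc'
  have hregm' : MeasurableSet {t : ↥T' | IsRegularElt (((t : Gqs L v)).val : GL (Fin 3) (LocalRing L v))} :=
    ((isOpen_setOf_isRegularElt_cmDatum_local (L := L) (H := qsForm L) (v := v) w (hns w)).preimage continuous_subtype_val).measurableSet
  have hpre : (⇑e) ⁻¹' {t : ↥T' | IsRegularElt (((t : Gqs L v)).val : GL (Fin 3) (LocalRing L v))} =
      {t : ↥T | IsRegularElt (((t : Gqs L v)).val : GL (Fin 3) (LocalRing L v))} :=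
    Set.ext fun t => ⟨fun h => isRegularElt_of_isConj (he t).symm h, fun h => isRegularElt_of_isConj (he t) h⟩
  have hme : Measurable (e : ↥T → ↥T') := e.continuous.measurable
  rw [← hmap, Measure.restrict_map hme hregm', hpre]

/-- **TRANSPORT, integral level** (change of variables along `e`, no integrability needed): with the data of `map_restrict_regular_eq_of_transport`, for every
`H : T′ → E`, `∫_{T^{reg}} H(e t) dt_T = ∫_{T′^{reg}} H dt_{T′}`. [cite: Rogawski1990, §4.3 (4.3.1) p. 43; §12.5 p. 182] -/
theorem setIntegral_comp_transport_eq (hns : ∀ w : PlacesOver L v, IsCMField.complexConj L • w.1 = w.1)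
    [MeasurableSpace (Gqs L v)] [BorelSpace (Gqs L v)] {T T' : Subgroup (Gqs L v)} (hT' : IsClosed (T' : Set (Gqs L v)))
    (e : ↥T ≃ₜ* ↥T') (he : ∀ t : ↥T, IsStablyConjGAt L (R90.S4.splitFormGL L) v (t : Gqs L v) ((e t : ↥T') : Gqs L v))
    (tT : Measure ↥T) [tT.IsHaarMeasure] (tT' : Measure ↥T') [tT'.IsHaarMeasure] (htc : tT (compactCore ↥T) = 1) (htc' : tT' (compactCore ↥T') = 1)
    {E : Type} [NormedAddCommGroup E] [NormedSpace ℝ E] (H : ↥T' → E) :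
    ∫ t in {t : ↥T | IsRegularElt (((t : Gqs L v)).val : GL (Fin 3) (LocalRing L v))}, H (e t) ∂tT =
      ∫ t in {t : ↥T' | IsRegularElt (((t : Gqs L v)).val : GL (Fin 3) (LocalRing L v))}, H t ∂tT' := by
  have hme : MeasurableEmbedding (e : ↥T → ↥T') := e.toHomeomorph.measurableEmbedding
  rw [← map_restrict_regular_eq_of_transport L v hns hT' e he tT tT' htc htc', hme.integral_map]

/-- **TRANSPORT of the weighted torus integral of a stable class function** (the lemma both (W-NP) payers use, S4-R26 (4)): with the data of
`map_restrict_regular_eq_of_transport`, if moreover the Weyl weights correspond on regular elements (`D_{T′}(e t) = D_T(t)`) and `G : G_v → E` takes the same value at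
stably conjugate points, then `∫_{T′^{reg}} D_{T′} · G dt_{T′} = ∫_{T^{reg}} D_T · G dt_T`. [cite: Rogawski1990, §12.5 p. 182; §4.3 (4.3.1) p. 43] -/
theorem setIntegral_cartanWeight_smul_eq_of_transport (hns : ∀ w : PlacesOver L v, IsCMField.complexConj L • w.1 = w.1)
    [MeasurableSpace (Gqs L v)] [BorelSpace (Gqs L v)] {T T' : Subgroup (Gqs L v)} (hT' : IsClosed (T' : Set (Gqs L v)))
    (e : ↥T ≃ₜ* ↥T') (he : ∀ t : ↥T, IsStablyConjGAt L (R90.S4.splitFormGL L) v (t : Gqs L v) ((e t : ↥T') : Gqs L v))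
    (hw : ∀ t : ↥T, IsRegularElt (((t : Gqs L v)).val : GL (Fin 3) (LocalRing L v)) → cartanWeight L v T' (e t) = cartanWeight L v T t)
    (tT : Measure ↥T) [tT.IsHaarMeasure] (tT' : Measure ↥T') [tT'.IsHaarMeasure] (htc : tT (compactCore ↥T) = 1) (htc' : tT' (compactCore ↥T') = 1)
    {E : Type} [NormedAddCommGroup E] [NormedSpace ℝ E] (G : Gqs L v → E)
    (hG : ∀ γ γ' : Gqs L v, IsStablyConjGAt L (R90.S4.splitFormGL L) v γ γ' → G γ = G γ') :
    ∫ t in {t : ↥T' | IsRegularElt (((t : Gqs L v)).val : GL (Fin 3) (LocalRing L v))}, (cartanWeight L v T' t : ℝ) • G (t : Gqs L v) ∂tT' =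
      ∫ t in {t : ↥T | IsRegularElt (((t : Gqs L v)).val : GL (Fin 3) (LocalRing L v))}, (cartanWeight L v T t : ℝ) • G (t : Gqs L v) ∂tT := by
  obtain ⟨w⟩ := (inferInstance : Nonempty (PlacesOver L v))
  have hregm : MeasurableSet {t : ↥T | IsRegularElt (((t : Gqs L v)).val : GL (Fin 3) (LocalRing L v))} :=
    ((isOpen_setOf_isRegularElt_cmDatum_local (L := L) (H := qsForm L) (v := v) w (hns w)).preimage continuous_subtype_val).measurableSet
  rw [← setIntegral_comp_transport_eq L v hns hT' e he tT tT' htc htc' (fun t : ↥T' => (cartanWeight L v T' t : ℝ) • G (t : Gqs L v))]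
  refine setIntegral_congr_fun hregm fun t ht => ?_
  simp only [hw t ht, hG _ _ (he t)]

/-! ## §4 Per-member integrability of `D_T · Φ(⟦·⟧, f) · α` on `T^{reg}` (★ (E1b), as inside ★ (B2-N)'s proof) -/

/-- **On every member `T` of the Cartan system, `t ↦ D_T(t) · Φ(⟦t⟧, f) · α(t)` is integrable on `T^{reg}` for `t_T`** (`v` non-split; `f ∈ C_c^∞(G_v)`, `α` continuous and a
class function on the regular set): the torus factor of the product-chart integrability ★ (E1b) `integral_cartanSet_eq_of_tubeJacobian_local` (fed, as in ★ (B2-N), with ★ (J6) at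
`M` and ★ JAC-ELL C8 at the compact members), read through ★ `classOrbitalIntegral_mk_eq_integral_conjFamily_cartan`.  Exported because the stable regrouping (§6) must
interchange `∫_{T^{reg}}` with the finite sum `Φ^{st} = Σ_j Φ(⟦e_j ·⟧, f)`. [cite: Rogawski1990, §12.5 p. 182; §4.3 (4.3.1) p. 43] [cite: HarishChandra1970, Lemma 22; Lemma 42] -/
theorem integrable_cartanWeight_smul_classOrbitalIntegral_mul (hns : ∀ w : PlacesOver L v, IsCMField.complexConj L • w.1 = w.1)
    [MeasurableSpace (Gqs L v)] [BorelSpace (Gqs L v)]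
    [∀ γ' : Gqs L v, MeasurableSpace (Gqs L v ⧸ Subgroup.centralizer ({γ'} : Set (Gqs L v)))]
    [∀ γ' : Gqs L v, BorelSpace (Gqs L v ⧸ Subgroup.centralizer ({γ'} : Set (Gqs L v)))]
    {C : Finset (Subgroup (Gqs L v))}
    (hZ : ∀ T ∈ C, ∃ γ₀ : Gqs L v, IsRegularElt (γ₀.val : GL (Fin 3) (LocalRing L v)) ∧ T = Subgroup.centralizer ({γ₀} : Set (Gqs L v)))
    (hcpt : ∀ T ∈ C, T ≠ (cmBorelTriple L 3 v).M → IsCompact (T : Set (Gqs L v)))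
    (νG : Measure (Gqs L v)) [νG.IsHaarMeasure] [νG.IsMulRightInvariant]
    (mG : OrbitalMeasureFamily (Gqs L v)) (hcan : mG.IsCanonical (fun γ : Gqs L v => IsRegularElt (γ.val : GL (Fin 3) (LocalRing L v))) νG)
    (tT : ∀ i : ↥C, Measure ↥(i : Subgroup (Gqs L v))) (htH : ∀ i : ↥C, (tT i).IsHaarMeasure) (htI : ∀ i : ↥C, (tT i).IsInvInvariant)
    (htc : ∀ i : ↥C, tT i (compactCore ↥(i : Subgroup (Gqs L v))) = 1)
    {f α : Gqs L v → ℂ} (hf : IsLocSmooth f) (hα : Continuous α)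
    (hαcl : ∀ x γ : Gqs L v, IsRegularElt (γ.val : GL (Fin 3) (LocalRing L v)) → α (x * γ * x⁻¹) = α γ) (i : ↥C) :
    Integrable (fun t : ↥(i : Subgroup (Gqs L v)) =>
        (cartanWeight L v (i : Subgroup (Gqs L v)) t : ℝ≥0) • (classOrbitalIntegral mG f (ConjClasses.mk (t : Gqs L v)) * α (t : Gqs L v)))
      ((tT i).restrict {t : ↥(i : Subgroup (Gqs L v)) | IsRegularElt (((t : Gqs L v)).val : GL (Fin 3) (LocalRing L v))}) := by
  classical
  obtain ⟨w⟩ := (inferInstance : Nonempty (PlacesOver L v))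
  -- (1) the regular generator and the conjugation chart of the member `i`
  choose γ₀ hγ₀ hTeq using hZ
  have hab : ∀ a ∈ (i : Subgroup (Gqs L v)), ∀ b ∈ (i : Subgroup (Gqs L v)), a * b = b * a := by
    intro a ha b hb
    rw [hTeq i i.2] at ha hb
    exact mul_comm_of_mem_centralizer L v (hγ₀ i i.2) a ha b hb
  obtain ⟨Φc, hΦc⟩ := exists_conjFamily (i : Subgroup (Gqs L v)) hab
  haveI hH : (tT i).IsHaarMeasure := htH i
  haveI hI : (tT i).IsInvInvariant := htI i
  letI hmsQ : MeasurableSpace (Gqs L v ⧸ (i : Subgroup (Gqs L v))) := borel _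
  haveI hbQ : BorelSpace (Gqs L v ⧸ (i : Subgroup (Gqs L v))) := ⟨rfl⟩
  -- (2) the weight
  let DM : ↥(cmBorelTriple L 3 v).M → ℝ≥0 := fun t => Real.toNNReal ((F0P3cStCharTSTorusDefs.vanDijkWeight L v t).re ^ 2)
  have hDM : ∀ t : ↥(cmBorelTriple L 3 v).M, (DM t : ℝ) = ((F0P3cStCharTSTorusDefs.vanDijkWeight L v t).re) ^ 2 :=
    fun t => Real.coe_toNNReal _ (sq_nonneg _)
  let D : ↥(i : Subgroup (Gqs L v)) → ℝ≥0 := cartanWeight L v (i : Subgroup (Gqs L v))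
  have hD : Measurable D := measurable_cartanWeight L v hns (i : Subgroup (Gqs L v))
  -- (3) the tube Jacobian of the member: ★ (J6) at `M`, ★ JAC-ELL C8 at a compact member
  obtain ⟨w₀, hw₀⟩ := F0P3cStCharTSVanDijkWeylSymm.exists_weylElt L v
  have hJac : ∀ t₀ : ↥(i : Subgroup (Gqs L v)), IsRegularElt (((t₀ : Gqs L v)).val : GL (Fin 3) (LocalRing L v)) →
      ∃ U : Set ↥(i : Subgroup (Gqs L v)), IsOpen U ∧ t₀ ∈ U ∧
        ∃ A₀ : Set (Gqs L v ⧸ (i : Subgroup (Gqs L v))), MeasurableSet A₀ ∧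
          (quotientMeasure (i : Subgroup (Gqs L v)) (tT i) (isClosed_cartan (hTeq i i.2)) νG) A₀ ≠ 0 ∧
          (quotientMeasure (i : Subgroup (Gqs L v)) (tT i) (isClosed_cartan (hTeq i i.2)) νG) A₀ ≠ ∞ ∧
          ∀ V : Set ↥(i : Subgroup (Gqs L v)), MeasurableSet V → V ⊆ U →
            (∀ t ∈ V, IsRegularElt (((t : Gqs L v)).val : GL (Fin 3) (LocalRing L v))) →
            (∀ n : Gqs L v, n ∉ (i : Subgroup (Gqs L v)) → ∀ t ∈ V, ∀ t' ∈ V, ((t' : ↥(i : Subgroup (Gqs L v))) : Gqs L v) ≠ n * t * n⁻¹) →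
              νG (Φc '' (A₀ ×ˢ V)) = (quotientMeasure (i : Subgroup (Gqs L v)) (tT i) (isClosed_cartan (hTeq i i.2)) νG) A₀ *
                ∫⁻ t in V, (D t : ℝ≥0∞) ∂(tT i) := by
    intro t₀ ht₀
    by_cases h : (i : Subgroup (Gqs L v)) = (cmBorelTriple L 3 v).M
    · show ∃ U, IsOpen U ∧ t₀ ∈ U ∧ ∃ A₀, MeasurableSet A₀ ∧ _ ∧ _ ∧ ∀ V, MeasurableSet V → V ⊆ U → _ → _ →
        νG (Φc '' (A₀ ×ˢ V)) = _ * ∫⁻ t in V, (cartanWeight L v (i : Subgroup (Gqs L v)) t : ℝ≥0∞) ∂(tT i)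
      rw [cartanWeight_of_eq L v h]
      exact tubeJacobianLocal_cartan_Gqs_vanDijkWeight_sq L v hns νG h (isClosed_cartan (hTeq i i.2)) Φc hΦc (tT i) (htc i) w₀ hw₀
        DM (fun t : ↥(i : Subgroup (Gqs L v)) => DM ⟨(t : Gqs L v), h ▸ t.2⟩) (fun t t' htt' => congrArg DM (Subtype.ext htt')) hDM t₀ ht₀
    · show ∃ U, IsOpen U ∧ t₀ ∈ U ∧ ∃ A₀, MeasurableSet A₀ ∧ _ ∧ _ ∧ ∀ V, MeasurableSet V → V ⊆ U → _ → _ →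
        νG (Φc '' (A₀ ×ˢ V)) = _ * ∫⁻ t in V, (cartanWeight L v (i : Subgroup (Gqs L v)) t : ℝ≥0∞) ∂(tT i)
      rw [cartanWeight_of_ne L v h]
      obtain ⟨U, hUo, ht₀U, A₀, hA₀m, hA₀0, hA₀top, hJ⟩ :=
        F0P3cStCharTSJacCartanTerminus.tubeJacobianSocket_compactCartan L v hns νG (i : Subgroup (Gqs L v)) (γ₀ i i.2) (hγ₀ i i.2) (hTeq i i.2)
          (hcpt i i.2 h) (tT i) hH hI (htc i) t₀ ht₀
      refine ⟨U, hUo, ht₀U, A₀, hA₀m, hA₀0, hA₀top, fun V hVm hVU hVreg hVW => ?_⟩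
      have htube : Φc '' (A₀ ×ˢ V) = {y : Gqs L v | ∃ (x : Gqs L v) (t : ↥(i : Subgroup (Gqs L v))),
          (QuotientGroup.mk x : Gqs L v ⧸ (i : Subgroup (Gqs L v))) ∈ A₀ ∧ t ∈ V ∧ y = x * t * x⁻¹} := by
        ext y
        constructor
        · rintro ⟨⟨q, t⟩, ⟨hq, ht⟩, rfl⟩
          obtain ⟨x, rfl⟩ := QuotientGroup.mk_surjective q
          exact ⟨x, t, hq, ht, hΦc x t⟩
        · rintro ⟨x, t, hx, ht, rfl⟩
          exact ⟨(QuotientGroup.mk x, t), ⟨hx, ht⟩, hΦc x t⟩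
      rw [htube]
      exact hJ V hVm hVU hVreg hVW
  -- (4) the torus factor of ★ (E1b)'s product integrability
  have hregm : MeasurableSet {t : ↥(i : Subgroup (Gqs L v)) | IsRegularElt (((t : Gqs L v)).val : GL (Fin 3) (LocalRing L v))} :=
    ((isOpen_setOf_isRegularElt_cmDatum_local (L := L) (H := qsForm L) (v := v) w (hns w)).preimage continuous_subtype_val).measurableSet
  have hfm : Measurable f := hf.continuous.measurable
  have hfα : Integrable (fun y => f y * α y) νG :=
    (hf.continuous.mul hα).integrable_of_hasCompactSupport hf.hasCompactSupport.mul_right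
  obtain ⟨hprod, -⟩ := integral_cartanSet_eq_of_tubeJacobian_local (hγ₀ i i.2) (hTeq i i.2) Φc hΦc hns νG (tT i) D hD hJac
    (fun y => f y * α y) hfα.integrableOn
  have h1 : Integrable (fun t : ↥(i : Subgroup (Gqs L v)) => ∫ q, (fun y => f y * α y) (Φc (q, t))
      ∂(quotientMeasure (i : Subgroup (Gqs L v)) (tT i) (isClosed_cartan (hTeq i i.2)) νG))
      (((tT i).restrict {t | IsRegularElt (((t : Gqs L v)).val : GL (Fin 3) (LocalRing L v))}).withDensity fun t => (D t : ℝ≥0∞)) :=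
    hprod.integral_prod_left
  rw [integrable_withDensity_iff_integrable_smul hD] at h1
  refine h1.congr ?_
  filter_upwards [ae_restrict_mem hregm] with t ht
  have hpt : ∀ q : Gqs L v ⧸ (i : Subgroup (Gqs L v)), f (Φc (q, t)) * α (Φc (q, t)) = f (Φc (q, t)) * α (t : Gqs L v) := by
    intro q
    induction q using QuotientGroup.induction_on with
    | H x => rw [hΦc x t, hαcl x (t : Gqs L v) ht]
  simp only [hpt, integral_mul_const]
  rw [classOrbitalIntegral_mk_eq_integral_conjFamily_cartan (hγ₀ i i.2) (hTeq i i.2) νG hcan (tT i) (htc i) Φc hΦc t ht f hfm]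

end StableTransportDict

end Summit.HodgeConjecture.HodgeConjecture.R90.S4

end
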